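import Mathlib
import HarnessLib
import Summits.HubbardSuperconductivity.HubbardSuperconductivity.Theorems.KLProgrammeKLRegimeEnginePairTransferDLineTwoShell
import Summits.HubbardSuperconductivity.HubbardSuperconductivity.Theorems.KLProgrammeKLRegimeEnginePairTransferDLineTwoShellCrossed
import Summits.HubbardSuperconductivity.HubbardSuperconductivity.Theorems.KLProgrammeKLRegimeEngineFlowSliceWeights

/-!
# Route `KLProgramme` — ENGINE item stmt-HubbardSuperconductivity-20437 `KLRegimeEngineV17F2`, class-#5 STEP (X).3: THE MEMBER PH MASS ABOVE THE TRANSFER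
# THRESHOLD — the two-shell law for the FAT partner `Φ_j(t)` (all modes below the running cutoff `Λ(t)`) against the slice line at transfer `x − y`
# (cell gate-hubbard-kl, seat hubbard-kl-k3c2-p2 g17; companion of gen 16's `WDd_sum_le_twoShell` for the `D`-line)

WHY.  The signed member rows (…MemberPHSigned(Row)) cover SMALL transfer `G|p_{x−y}|_𝕋 ≤ Λₙ₊₁/8`; above it the ROOM's slot is `Λₙ₊₁/|k − k′|_𝕋` + the caustic
`2⁻ⁿ`, which the sign-blind two-shell law supplies.  Gen 16's `WDd_sum_le_twoShell` did this for the thin `D`-line of a deep pair (radius `Λ_{j′} ≤ Λ(t)/4`);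
here the partner is the member symbol `Φ_j(t) = w_{Λ_j} − w_{Λ(t)}`, supported in `ρ < Λ(t)` (`…EngineFlowSliceWeights`), so `twoShell_weighted_sum_le` is read
at `(Λ′, ε₂) = (Λ(t), 2Λ(t))` (its hypothesis `2Λ′ ≤ ε₂` holds trivially; the slice band `|e_K| ≤ Λ(t) ≤ 2Λ(t)`), under `2Λₙ + Gδ ≤ klE0` (`n ≥ 1`):

* `radius_lt_of_member_ne_zero`, `abs_member_le_one`, `memberProd_le_indicator`;
* **`Wd_member_sum_le_twoShell`**: the literal direct member mass of `klmd_defect_le_masses_family` / (via the triangle inequality) the norm of row `hP` times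
  the kernel sup: `≤ (512/3)(βL²)²/Λ(t)²·(9AL²/2π²)·((2Λ(t)+Gδ)/r + √(2Λ(t)+Gδ))·[(βΛ(t)/π)(10+2Gβ/L) + 12Gβ/L]`, `0 < r ≤ |x − y|_𝕋` — in the ROOM's currency
  `(Λₙ−Λₙ₊₁)(βL²)⁻³·(…) ≍ A·(Λ(t)/r + √Λ(t))·O(G²)` = the `Λₙ₊₁/|k−k′|` min-slot + the `2⁻ⁿ` caustic slot with an O(1) (not `4^{−(j′−n)}`) coefficient.

Counting/arithmetic over landed packages; nothing about the model's effective action is asserted; nothing asserts (X).3, (c), K3 or superconductivity.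
-/

noncomputable section

namespace Summit.HubbardSuperconductivity.HubbardSuperconductivity.Theorems.KLRegimeSplit

set_option linter.dupNamespace false -- summit = problem name (single-conjunct summit), D-0017

open Real Finset Set Literature.MathematicalPhysics.QuantumLattice Literature.Probability.LatticeModels
open Literature.MathematicalPhysics.QuantumLattice.FermiRG
open Summit.HubbardSuperconductivity.HubbardSuperconductivity.Theorems.KLProgrammeLegKernels
open Summit.HubbardSuperconductivity.HubbardSuperconductivity.Theorems.TwoPointAssembly
open Summit.HubbardSuperconductivity.HubbardSuperconductivity.Theorems.DispersionFlow
open Summit.HubbardSuperconductivity.HubbardSuperconductivity.Theorems.KLRegimeWick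
open Summit.HubbardSuperconductivity.HubbardSuperconductivity.Theorems.EngineV8
open Summit.HubbardSuperconductivity.HubbardSuperconductivity.Theorems.PerturbedFermiCurve

variable {L M : ℕ} (β μ : ℝ) (K : TrigPolyC4v)

/-! ## §1 The member weight: support, size, and the product against the indicator -/

/-- The member symbol vanishes off `ρ < Λ`: `Φ_j(p) ≠ 0 ⇒ ω² + e_K² < Λ²` (`n+1 ≤ j`, `Λₙ₊₁ ≤ Λ`). -/
theorem radius_lt_of_member_ne_zero [NeZero L] (n : ℕ) {j : ℕ} (hj : n + 1 ≤ j) {Λ : ℝ} (hlo : klScale klE0 (n + 1) ≤ Λ) (p : FreqMomentum L M)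
    (h : softSymbolCompl L M β μ K (n + 1) j p +
        (hubbardCutoffWeightCT L M β μ K (klScale klE0 (n + 1)) p - hubbardCutoffWeightCT L M β μ K Λ p) ≠ 0) :
    matsubaraFreq β M p.1 ^ 2 + nambuXiCT L μ K p.2 ^ 2 < Λ ^ 2 := by
  rw [klfw_memberSymbol_eq β μ K n j Λ p] at h
  by_contra hge
  have hΛj := klth_klScale_pos j
  have hanti : klScale klE0 j ≤ klScale klE0 (n + 1) := by
    unfold klScale
    exact mul_le_mul_of_nonneg_left (inv_anti₀ (by positivity) (pow_le_pow_right₀ (by norm_num) hj)) (by unfold klE0; norm_num)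
  exact h (klPhi_eq_zero_of_ge hΛj (hanti.trans hlo) (not_lt.mp hge))

/-- `|Φ_j(p)| ≤ 1`. -/
theorem abs_member_le_one [NeZero L] (n j : ℕ) (Λ : ℝ) (p : FreqMomentum L M) :
    |softSymbolCompl L M β μ K (n + 1) j p + (hubbardCutoffWeightCT L M β μ K (klScale klE0 (n + 1)) p - hubbardCutoffWeightCT L M β μ K Λ p)| ≤ 1 := by
  rw [klfw_memberSymbol_eq β μ K n j Λ p]; exact abs_klPhi_le_one _ _ _

/-- **One product of the member mass against the two-shell indicator** (cf. `dirProd_le_indicator`): partner disc `ρ ≤ Λ`, slice band `|e_K| ≤ Λ ≤ 2Λ`. -/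
theorem memberProd_le_indicator [NeZero L] {β : ℝ} (hβ : 0 < β) (μ : ℝ) (K : TrigPolyC4v) (n : ℕ) {j : ℕ} (hj : n + 1 ≤ j) {Λ : ℝ}
    (hlo : klScale klE0 (n + 1) ≤ Λ) (hΛ : 0 < Λ) (q : TorusSite 2 L) (p : FreqMomentum L M) :
    |softSymbolCompl L M β μ K (n + 1) j p + (hubbardCutoffWeightCT L M β μ K (klScale klE0 (n + 1)) p - hubbardCutoffWeightCT L M β μ K Λ p)| *
          ((β * (L : ℝ) ^ 2) * ‖propCT L M β μ K p‖) *
        (|deriv (fun Λ' : ℝ => hubbardCutoffWeightCT L M β μ K Λ' (p.1, p.2 + q)) Λ| * ((β * (L : ℝ) ^ 2) * ‖propCT L M β μ K (p.1, p.2 + q)‖)) ≤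
      (β * (L : ℝ) ^ 2) ^ 2 * (128 / (3 * Λ ^ 2)) *
        (if matsubaraFreq β M p.1 ^ 2 + nambuXiCT L μ K p.2 ^ 2 ≤ Λ ^ 2 ∧ |nambuXiCT L μ K (p.2 + q)| ≤ 2 * Λ then
          (Real.sqrt (matsubaraFreq β M p.1 ^ 2 + nambuXiCT L μ K p.2 ^ 2))⁻¹ else 0) := by
  have hβL : 0 < β * (L : ℝ) ^ 2 := by
    have : (0 : ℝ) < L := by exact_mod_cast Nat.pos_of_ne_zero (NeZero.ne L)
    positivity
  by_cases hD : softSymbolCompl L M β μ K (n + 1) j p + (hubbardCutoffWeightCT L M β μ K (klScale klE0 (n + 1)) p - hubbardCutoffWeightCT L M β μ K Λ p) = 0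
  · rw [hD, abs_zero, zero_mul, zero_mul]
    split_ifs <;> positivity
  by_cases hW : deriv (fun Λ' : ℝ => hubbardCutoffWeightCT L M β μ K Λ' (p.1, p.2 + q)) Λ = 0
  · rw [hW, abs_zero, zero_mul, mul_zero]
    split_ifs <;> positivity
  have hrad := radius_lt_of_member_ne_zero β μ K n hj hlo p hD
  have he := abs_nambuXiCT_le_of_slice_ne_zero β μ K hΛ (p.1, p.2 + q) hW
  rw [if_pos ⟨hrad.le, he.trans (by linarith)⟩]
  have h1 := abs_member_le_one β μ K n j Λ p
  have h2 := slice_factor_le β μ K hΛ (p.1, p.2 + q)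
  have h3 : ‖propCT L M β μ K p‖ = (Real.sqrt (matsubaraFreq β M p.1 ^ 2 + nambuXiCT L μ K p.2 ^ 2))⁻¹ := norm_propCT_eq (L := L) (M := M) (β := β) (μ := μ) (K := K) p
  rw [← h3]
  have hn : 0 ≤ ‖propCT L M β μ K p‖ := norm_nonneg _
  calc _ = (|softSymbolCompl L M β μ K (n + 1) j p + (hubbardCutoffWeightCT L M β μ K (klScale klE0 (n + 1)) p - hubbardCutoffWeightCT L M β μ K Λ p)|) *
        (|deriv (fun Λ' : ℝ => hubbardCutoffWeightCT L M β μ K Λ' (p.1, p.2 + q)) Λ| * ‖propCT L M β μ K (p.1, p.2 + q)‖) *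
          ((β * (L : ℝ) ^ 2) ^ 2 * ‖propCT L M β μ K p‖) := by ring
    _ ≤ 1 * (128 / (3 * Λ ^ 2)) * ((β * (L : ℝ) ^ 2) ^ 2 * ‖propCT L M β μ K p‖) := by
        gcongr
    _ = _ := by ring

/-! ## §2 The member mass above threshold: the two-shell law -/

/-- **THE MEMBER PH MASS ABOVE THE TRANSFER THRESHOLD** (see the module docstring). -/
theorem Wd_member_sum_le_twoShell [NeZero L] [NeZero M] {A : ℝ} {u : RenConsts → ℝ} (h : TwoShellFrameAreaAt A u) (hA : 0 ≤ A) {R : RenConsts}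
    (hR : R.WF2) {U : ℝ} (hU : 0 < U) (hUu : U ≤ u R) (hμ : μ ∈ klWindowC) {N : ℕ} (hK : FrameOK R U N μ K) (hβ : 0 < β)
    (n : ℕ) {j : ℕ} (hj : n + 1 ≤ j) {t : ℝ} (ht : t ∈ Icc (0 : ℝ) 1)
    (hE0 : 2 * klScale klE0 n + (4 + 8 / 3 * R.Gfr 1 * U ^ 2) * (2 * π / L) ≤ klE0) {x y : TorusSite 2 L} {r : ℝ} (hr : 0 < r)
    (hrw : r ≤ klTorusNorm L (x - y)) :
    ∑ p : FreqMomentum L M, ∑ _σ : Fin 2, ∑ p' : FreqMomentum L M,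
      (if matsubaraInt M p'.1 + matsubaraInt M (omega0 M) = matsubaraInt M p.1 + matsubaraInt M (omega0 M) ∧ p'.2 = p.2 + x - y then
        ‖((((softSymbolCompl L M β μ K (n + 1) j p + (hubbardCutoffWeightCT L M β μ K (klScale klE0 (n + 1)) p - hubbardCutoffWeightCT L M β μ K (klScale klE0 n + t * (klScale klE0 (n + 1) - klScale klE0 n)) p) : ℝ)) : ℂ) * (((β * (L : ℝ) ^ 2 : ℝ) : ℂ) * propCT L M β μ K p)) *
            ((((deriv (fun Λ' : ℝ => hubbardCutoffWeightCT L M β μ K Λ' p') (klScale klE0 n + t * (klScale klE0 (n + 1) - klScale klE0 n)) : ℝ)) : ℂ) *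
              (((β * (L : ℝ) ^ 2 : ℝ) : ℂ) * propCT L M β μ K p')) +
          ((((deriv (fun Λ' : ℝ => hubbardCutoffWeightCT L M β μ K Λ' p) (klScale klE0 n + t * (klScale klE0 (n + 1) - klScale klE0 n)) : ℝ)) : ℂ) *
              (((β * (L : ℝ) ^ 2 : ℝ) : ℂ) * propCT L M β μ K p)) *
            ((((softSymbolCompl L M β μ K (n + 1) j p' + (hubbardCutoffWeightCT L M β μ K (klScale klE0 (n + 1)) p' - hubbardCutoffWeightCT L M β μ K (klScale klE0 n + t * (klScale klE0 (n + 1) - klScale klE0 n)) p') : ℝ)) : ℂ) * (((β * (L : ℝ) ^ 2 : ℝ) : ℂ) * propCT L M β μ K p'))‖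
      else 0) ≤
      512 / 3 * (β * (L : ℝ) ^ 2) ^ 2 / (klScale klE0 n + t * (klScale klE0 (n + 1) - klScale klE0 n)) ^ 2 *
        (9 * A * (L : ℝ) ^ 2 / (2 * π ^ 2) *
          ((2 * (klScale klE0 n + t * (klScale klE0 (n + 1) - klScale klE0 n)) + (4 + 8 / 3 * R.Gfr 1 * U ^ 2) * (2 * π / L)) / r +
            Real.sqrt (2 * (klScale klE0 n + t * (klScale klE0 (n + 1) - klScale klE0 n)) + (4 + 8 / 3 * R.Gfr 1 * U ^ 2) * (2 * π / L))) *
          (β * (klScale klE0 n + t * (klScale klE0 (n + 1) - klScale klE0 n)) / π * (10 + 2 * (4 + 8 / 3 * R.Gfr 1 * U ^ 2) * β / L) +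
            12 * (4 + 8 / 3 * R.Gfr 1 * U ^ 2) * β / L)) := by
  classical
  set Λ : ℝ := klScale klE0 n + t * (klScale klE0 (n + 1) - klScale klE0 n) with hΛdef
  have hΛ : 0 < Λ := scaleAt_pos n ht
  have hβL : 0 < β * (L : ℝ) ^ 2 := by
    have : (0 : ℝ) < L := by exact_mod_cast Nat.pos_of_ne_zero (NeZero.ne L)
    positivity
  set G : ℝ := 4 + 8 / 3 * R.Gfr 1 * U ^ 2 with hG
  set q : TorusSite 2 L := x - y with hq
  -- the weighted two-shell bound at `(Λ′, ε₂) = (Λ(t), 2Λ(t))`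
  have h2Λ : 2 * Λ ≤ 2 * Λ := le_rfl
  have hE : 2 * Λ + G * (2 * π / L) ≤ klE0 := by have := (scaleAt_mem n ht).2; rw [← hΛdef] at this; linarith
  set W : ℝ := 9 * A * (L : ℝ) ^ 2 / (2 * π ^ 2) * ((2 * Λ + G * (2 * π / L)) / r + Real.sqrt (2 * Λ + G * (2 * π / L))) *
      (β * Λ / π * (10 + 2 * G * β / L) + 12 * G * β / L) with hW
  have hWq : ∑ p ∈ univ.filter (fun p : FreqMomentum L M => matsubaraFreq β M p.1 ^ 2 + nambuXiCT L μ K p.2 ^ 2 ≤ Λ ^ 2 ∧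
      |nambuXiCT L μ K (p.2 - q)| ≤ 2 * Λ), (Real.sqrt (matsubaraFreq β M p.1 ^ 2 + nambuXiCT L μ K p.2 ^ 2))⁻¹ ≤ W :=
    twoShell_weighted_sum_le h hA hR hU hUu hμ hK hβ hΛ h2Λ hE q hr hrw
  have hrw' : r ≤ klTorusNorm L (-q) := by rw [hq, neg_sub, klvr_klTorusNorm_sub_comm]; exact hrw
  have hWnq : ∑ p ∈ univ.filter (fun p : FreqMomentum L M => matsubaraFreq β M p.1 ^ 2 + nambuXiCT L μ K p.2 ^ 2 ≤ Λ ^ 2 ∧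
      |nambuXiCT L μ K (p.2 - -q)| ≤ 2 * Λ), (Real.sqrt (matsubaraFreq β M p.1 ^ 2 + nambuXiCT L μ K p.2 ^ 2))⁻¹ ≤ W :=
    twoShell_weighted_sum_le h hA hR hU hUu hμ hK hβ hΛ h2Λ hE (-q) hr hrw'
  have hlo : klScale klE0 (n + 1) ≤ Λ := by have := (scaleAt_mem n ht).1; rw [← hΛdef] at this; exact this
  -- abbreviations for the two weights
  set D : FreqMomentum L M → ℝ := fun p => softSymbolCompl L M β μ K (n + 1) j p +
    (hubbardCutoffWeightCT L M β μ K (klScale klE0 (n + 1)) p - hubbardCutoffWeightCT L M β μ K Λ p) with hDdef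
  set Wd : FreqMomentum L M → ℝ := fun p => deriv (fun Λ' : ℝ => hubbardCutoffWeightCT L M β μ K Λ' p) Λ with hWddef
  -- step 1: collapse the partner sum and the spin sum
  have hcollapse : ∀ p : FreqMomentum L M,
      (∑ _σ : Fin 2, ∑ p' : FreqMomentum L M,
        (if matsubaraInt M p'.1 + matsubaraInt M (omega0 M) = matsubaraInt M p.1 + matsubaraInt M (omega0 M) ∧ p'.2 = p.2 + x - y then
          ‖(((D p : ℝ) : ℂ) * (((β * (L : ℝ) ^ 2 : ℝ) : ℂ) * propCT L M β μ K p)) * (((Wd p' : ℝ) : ℂ) * (((β * (L : ℝ) ^ 2 : ℝ) : ℂ) * propCT L M β μ K p')) +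
            (((Wd p : ℝ) : ℂ) * (((β * (L : ℝ) ^ 2 : ℝ) : ℂ) * propCT L M β μ K p)) * (((D p' : ℝ) : ℂ) * (((β * (L : ℝ) ^ 2 : ℝ) : ℂ) * propCT L M β μ K p'))‖
        else 0)) =
      2 * ‖(((D p : ℝ) : ℂ) * (((β * (L : ℝ) ^ 2 : ℝ) : ℂ) * propCT L M β μ K p)) *
            (((Wd (p.1, p.2 + q) : ℝ) : ℂ) * (((β * (L : ℝ) ^ 2 : ℝ) : ℂ) * propCT L M β μ K (p.1, p.2 + q))) +
          (((Wd p : ℝ) : ℂ) * (((β * (L : ℝ) ^ 2 : ℝ) : ℂ) * propCT L M β μ K p)) *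
            (((D (p.1, p.2 + q) : ℝ) : ℂ) * (((β * (L : ℝ) ^ 2 : ℝ) : ℂ) * propCT L M β μ K (p.1, p.2 + q)))‖ := by
    intro p
    rw [sum_partner_ite_eq x y p, Finset.sum_const, Finset.card_univ, Fintype.card_fin, nsmul_eq_mul]
    have e : p.2 + x - y = p.2 + q := by rw [hq]; abel
    rw [e]
    norm_num
  -- step 2: the two products against the indicators
  have hT : ∀ p : FreqMomentum L M,
      ‖(((D p : ℝ) : ℂ) * (((β * (L : ℝ) ^ 2 : ℝ) : ℂ) * propCT L M β μ K p)) *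
            (((Wd (p.1, p.2 + q) : ℝ) : ℂ) * (((β * (L : ℝ) ^ 2 : ℝ) : ℂ) * propCT L M β μ K (p.1, p.2 + q))) +
          (((Wd p : ℝ) : ℂ) * (((β * (L : ℝ) ^ 2 : ℝ) : ℂ) * propCT L M β μ K p)) *
            (((D (p.1, p.2 + q) : ℝ) : ℂ) * (((β * (L : ℝ) ^ 2 : ℝ) : ℂ) * propCT L M β μ K (p.1, p.2 + q)))‖ ≤
      (β * (L : ℝ) ^ 2) ^ 2 * (128 / (3 * Λ ^ 2)) *
        (if matsubaraFreq β M p.1 ^ 2 + nambuXiCT L μ K p.2 ^ 2 ≤ Λ ^ 2 ∧ |nambuXiCT L μ K (p.2 + q)| ≤ 2 * Λ then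
          (Real.sqrt (matsubaraFreq β M p.1 ^ 2 + nambuXiCT L μ K p.2 ^ 2))⁻¹ else 0) +
      (β * (L : ℝ) ^ 2) ^ 2 * (128 / (3 * Λ ^ 2)) *
        (if matsubaraFreq β M (p.1, p.2 + q).1 ^ 2 + nambuXiCT L μ K (p.1, p.2 + q).2 ^ 2 ≤ Λ ^ 2 ∧
            |nambuXiCT L μ K ((p.1, p.2 + q).2 + -q)| ≤ 2 * Λ then
          (Real.sqrt (matsubaraFreq β M (p.1, p.2 + q).1 ^ 2 + nambuXiCT L μ K (p.1, p.2 + q).2 ^ 2))⁻¹ else 0) := by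
    intro p
    refine (norm_add_le _ _).trans (add_le_add ?_ ?_)
    · rw [norm_weightProd_eq hβ]
      exact memberProd_le_indicator hβ μ K n hj hlo hΛ q p
    · rw [norm_weightProd_eq hβ]
      have h := memberProd_le_indicator hβ μ K n hj hlo hΛ (-q) (p.1, p.2 + q)
      have e : (p.1, p.2 + q).2 + -q = p.2 := by simp
      simp only [e] at h ⊢
      calc |Wd p| * ((β * (L : ℝ) ^ 2) * ‖propCT L M β μ K p‖) * (|D (p.1, p.2 + q)| * ((β * (L : ℝ) ^ 2) * ‖propCT L M β μ K (p.1, p.2 + q)‖))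
          = |D (p.1, p.2 + q)| * ((β * (L : ℝ) ^ 2) * ‖propCT L M β μ K (p.1, p.2 + q)‖) * (|Wd (p.1, p.2)| * ((β * (L : ℝ) ^ 2) * ‖propCT L M β μ K (p.1, p.2)‖)) := by
            simp only [Prod.mk.eta]; ring
        _ ≤ _ := h
  -- step 3: sum, and recognise the two weighted two-shell masses (the second after the shift `k ↦ k + q`)
  have hS1 : ∑ p : FreqMomentum L M,
      (if matsubaraFreq β M p.1 ^ 2 + nambuXiCT L μ K p.2 ^ 2 ≤ Λ ^ 2 ∧ |nambuXiCT L μ K (p.2 + q)| ≤ 2 * Λ then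
          (Real.sqrt (matsubaraFreq β M p.1 ^ 2 + nambuXiCT L μ K p.2 ^ 2))⁻¹ else 0) ≤ W := by
    rw [← Finset.sum_filter]
    have e : (univ.filter fun p : FreqMomentum L M => matsubaraFreq β M p.1 ^ 2 + nambuXiCT L μ K p.2 ^ 2 ≤ Λ ^ 2 ∧
        |nambuXiCT L μ K (p.2 + q)| ≤ 2 * Λ) = univ.filter fun p : FreqMomentum L M => matsubaraFreq β M p.1 ^ 2 + nambuXiCT L μ K p.2 ^ 2 ≤ Λ ^ 2 ∧
        |nambuXiCT L μ K (p.2 - -q)| ≤ 2 * Λ := by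
      congr 1; funext p; rw [sub_neg_eq_add]
    rw [e]; exact hWnq
  have hS2 : ∑ p : FreqMomentum L M,
      (if matsubaraFreq β M (p.1, p.2 + q).1 ^ 2 + nambuXiCT L μ K (p.1, p.2 + q).2 ^ 2 ≤ Λ ^ 2 ∧
            |nambuXiCT L μ K ((p.1, p.2 + q).2 + -q)| ≤ 2 * Λ then
          (Real.sqrt (matsubaraFreq β M (p.1, p.2 + q).1 ^ 2 + nambuXiCT L μ K (p.1, p.2 + q).2 ^ 2))⁻¹ else 0) ≤ W := by
    set g : FreqMomentum L M → ℝ := fun p' => if matsubaraFreq β M p'.1 ^ 2 + nambuXiCT L μ K p'.2 ^ 2 ≤ Λ ^ 2 ∧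
        |nambuXiCT L μ K (p'.2 + -q)| ≤ 2 * Λ then (Real.sqrt (matsubaraFreq β M p'.1 ^ 2 + nambuXiCT L μ K p'.2 ^ 2))⁻¹ else 0 with hg
    set e : FreqMomentum L M ≃ FreqMomentum L M := Equiv.prodCongr (Equiv.refl _) (Equiv.addRight q) with hedef
    have hsum : ∑ p : FreqMomentum L M, g (e p) = ∑ p : FreqMomentum L M, g p := Equiv.sum_comp e g
    have e1 : ∀ p : FreqMomentum L M, e p = (p.1, p.2 + q) := fun p => rfl
    simp only [e1, hg] at hsum
    rw [hsum, ← Finset.sum_filter]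
    have e2 : (univ.filter fun p : FreqMomentum L M => matsubaraFreq β M p.1 ^ 2 + nambuXiCT L μ K p.2 ^ 2 ≤ Λ ^ 2 ∧
        |nambuXiCT L μ K (p.2 + -q)| ≤ 2 * Λ) = univ.filter fun p : FreqMomentum L M => matsubaraFreq β M p.1 ^ 2 + nambuXiCT L μ K p.2 ^ 2 ≤ Λ ^ 2 ∧
        |nambuXiCT L μ K (p.2 - q)| ≤ 2 * Λ := by
      congr 1; funext p; rw [← sub_eq_add_neg]
    rw [e2]; exact hWq
  -- assemble
  have hc : 0 ≤ (β * (L : ℝ) ^ 2) ^ 2 * (128 / (3 * Λ ^ 2)) := by positivity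
  simp only [hDdef, hWddef] at hcollapse hT
  calc _ = ∑ p : FreqMomentum L M, 2 * ‖(((D p : ℝ) : ℂ) * (((β * (L : ℝ) ^ 2 : ℝ) : ℂ) * propCT L M β μ K p)) *
            (((Wd (p.1, p.2 + q) : ℝ) : ℂ) * (((β * (L : ℝ) ^ 2 : ℝ) : ℂ) * propCT L M β μ K (p.1, p.2 + q))) +
          (((Wd p : ℝ) : ℂ) * (((β * (L : ℝ) ^ 2 : ℝ) : ℂ) * propCT L M β μ K p)) *
            (((D (p.1, p.2 + q) : ℝ) : ℂ) * (((β * (L : ℝ) ^ 2 : ℝ) : ℂ) * propCT L M β μ K (p.1, p.2 + q)))‖ := Finset.sum_congr rfl fun p _ => hcollapse p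
    _ ≤ ∑ p : FreqMomentum L M, 2 * ((β * (L : ℝ) ^ 2) ^ 2 * (128 / (3 * Λ ^ 2)) *
        (if matsubaraFreq β M p.1 ^ 2 + nambuXiCT L μ K p.2 ^ 2 ≤ Λ ^ 2 ∧ |nambuXiCT L μ K (p.2 + q)| ≤ 2 * Λ then
          (Real.sqrt (matsubaraFreq β M p.1 ^ 2 + nambuXiCT L μ K p.2 ^ 2))⁻¹ else 0) +
      (β * (L : ℝ) ^ 2) ^ 2 * (128 / (3 * Λ ^ 2)) *
        (if matsubaraFreq β M (p.1, p.2 + q).1 ^ 2 + nambuXiCT L μ K (p.1, p.2 + q).2 ^ 2 ≤ Λ ^ 2 ∧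
            |nambuXiCT L μ K ((p.1, p.2 + q).2 + -q)| ≤ 2 * Λ then
          (Real.sqrt (matsubaraFreq β M (p.1, p.2 + q).1 ^ 2 + nambuXiCT L μ K (p.1, p.2 + q).2 ^ 2))⁻¹ else 0)) :=
        Finset.sum_le_sum fun p _ => mul_le_mul_of_nonneg_left (hT p) (by norm_num)
    _ = 2 * ((β * (L : ℝ) ^ 2) ^ 2 * (128 / (3 * Λ ^ 2))) * (∑ p : FreqMomentum L M,
        (if matsubaraFreq β M p.1 ^ 2 + nambuXiCT L μ K p.2 ^ 2 ≤ Λ ^ 2 ∧ |nambuXiCT L μ K (p.2 + q)| ≤ 2 * Λ then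
          (Real.sqrt (matsubaraFreq β M p.1 ^ 2 + nambuXiCT L μ K p.2 ^ 2))⁻¹ else 0) +
        ∑ p : FreqMomentum L M, (if matsubaraFreq β M (p.1, p.2 + q).1 ^ 2 + nambuXiCT L μ K (p.1, p.2 + q).2 ^ 2 ≤ Λ ^ 2 ∧
            |nambuXiCT L μ K ((p.1, p.2 + q).2 + -q)| ≤ 2 * Λ then
          (Real.sqrt (matsubaraFreq β M (p.1, p.2 + q).1 ^ 2 + nambuXiCT L μ K (p.1, p.2 + q).2 ^ 2))⁻¹ else 0)) := by
        rw [← Finset.sum_add_distrib, Finset.mul_sum]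
        exact Finset.sum_congr rfl fun p _ => by ring
    _ ≤ 2 * ((β * (L : ℝ) ^ 2) ^ 2 * (128 / (3 * Λ ^ 2))) * (W + W) := by gcongr
    _ = 512 / 3 * (β * (L : ℝ) ^ 2) ^ 2 / Λ ^ 2 * W := by field_simp; ring

/-! ## §3 The crossed member mass above threshold -/

/-- **One product of the crossed member mass against the two-shell indicator** (cf. `crossProd_le_indicator`): partner disc `ρ ≤ Λ`, slice band `|e_K| ≤ 2Λ`. -/
theorem memberCrossProd_le_indicator [NeZero L] {β : ℝ} (hβ : 0 < β) (μ : ℝ) (K : TrigPolyC4v) (n : ℕ) {j : ℕ} (hj : n + 1 ≤ j) {Λ : ℝ}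
    (hlo : klScale klE0 (n + 1) ≤ Λ) (hΛ : 0 < Λ) (p p' : FreqMomentum L M) :
    |softSymbolCompl L M β μ K (n + 1) j p + (hubbardCutoffWeightCT L M β μ K (klScale klE0 (n + 1)) p - hubbardCutoffWeightCT L M β μ K Λ p)| *
          ((β * (L : ℝ) ^ 2) * ‖propCT L M β μ K p‖) *
        (|deriv (fun Λ' : ℝ => hubbardCutoffWeightCT L M β μ K Λ' p') Λ| * ((β * (L : ℝ) ^ 2) * ‖propCT L M β μ K p'‖)) ≤
      (β * (L : ℝ) ^ 2) ^ 2 * (128 / (3 * Λ ^ 2)) *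
        (if matsubaraFreq β M p.1 ^ 2 + nambuXiCT L μ K p.2 ^ 2 ≤ Λ ^ 2 ∧ |nambuXiCT L μ K p'.2| ≤ 2 * Λ then
          (Real.sqrt (matsubaraFreq β M p.1 ^ 2 + nambuXiCT L μ K p.2 ^ 2))⁻¹ else 0) := by
  have hβL : 0 < β * (L : ℝ) ^ 2 := by
    have : (0 : ℝ) < L := by exact_mod_cast Nat.pos_of_ne_zero (NeZero.ne L)
    positivity
  by_cases hD : softSymbolCompl L M β μ K (n + 1) j p + (hubbardCutoffWeightCT L M β μ K (klScale klE0 (n + 1)) p - hubbardCutoffWeightCT L M β μ K Λ p) = 0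
  · rw [hD, abs_zero, zero_mul, zero_mul]
    split_ifs <;> positivity
  by_cases hW : deriv (fun Λ' : ℝ => hubbardCutoffWeightCT L M β μ K Λ' p') Λ = 0
  · rw [hW, abs_zero, zero_mul, mul_zero]
    split_ifs <;> positivity
  have hrad := radius_lt_of_member_ne_zero β μ K n hj hlo p hD
  have he := abs_nambuXiCT_le_of_slice_ne_zero β μ K hΛ p' hW
  rw [if_pos ⟨hrad.le, he.trans (by linarith)⟩]
  have h1 := abs_member_le_one β μ K n j Λ p
  have h2 := slice_factor_le β μ K hΛ p'
  have h3 : ‖propCT L M β μ K p‖ = (Real.sqrt (matsubaraFreq β M p.1 ^ 2 + nambuXiCT L μ K p.2 ^ 2))⁻¹ := norm_propCT_eq (L := L) (M := M) (β := β) (μ := μ) (K := K) p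
  rw [← h3]
  have hn : 0 ≤ ‖propCT L M β μ K p‖ := norm_nonneg _
  calc _ = (|softSymbolCompl L M β μ K (n + 1) j p + (hubbardCutoffWeightCT L M β μ K (klScale klE0 (n + 1)) p - hubbardCutoffWeightCT L M β μ K Λ p)|) *
        (|deriv (fun Λ' : ℝ => hubbardCutoffWeightCT L M β μ K Λ' p') Λ| * ‖propCT L M β μ K p'‖) *
          ((β * (L : ℝ) ^ 2) ^ 2 * ‖propCT L M β μ K p‖) := by ring
    _ ≤ 1 * (128 / (3 * Λ ^ 2)) * ((β * (L : ℝ) ^ 2) ^ 2 * ‖propCT L M β μ K p‖) := by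
        gcongr
    _ = _ := by ring

/-- **THE CROSSED MEMBER PH MASS ABOVE THE TRANSFER THRESHOLD** (transfer `x + y − Q_m`, crossed constraint; cf. `WDx_sum_le_twoShell`). -/
theorem Wx_member_sum_le_twoShell [NeZero L] [NeZero M] {A : ℝ} {u : RenConsts → ℝ} (h : TwoShellFrameAreaAt A u) (hA : 0 ≤ A) {R : RenConsts}
    (hR : R.WF2) {U : ℝ} (hU : 0 < U) (hUu : U ≤ u R) (hμ : μ ∈ klWindowC) {N : ℕ} (hK : FrameOK R U N μ K) (hβ : 0 < β)
    (n : ℕ) {j : ℕ} (hj : n + 1 ≤ j) {t : ℝ} (ht : t ∈ Icc (0 : ℝ) 1)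
    (hE0 : 2 * klScale klE0 n + (4 + 8 / 3 * R.Gfr 1 * U ^ 2) * (2 * π / L) ≤ klE0) {Qm x y : TorusSite 2 L} {r : ℝ} (hr : 0 < r)
    (hrw : r ≤ klTorusNorm L (x + y - Qm)) :
    ∑ p : FreqMomentum L M, ∑ p' : FreqMomentum L M,
      (if matsubaraInt M p'.1 + matsubaraInt M (omega0 M) + matsubaraInt M (omega0 M) + 1 = matsubaraInt M p.1 ∧ p'.2 = p.2 + Qm - x - y then
        ‖((((softSymbolCompl L M β μ K (n + 1) j p + (hubbardCutoffWeightCT L M β μ K (klScale klE0 (n + 1)) p - hubbardCutoffWeightCT L M β μ K (klScale klE0 n + t * (klScale klE0 (n + 1) - klScale klE0 n)) p) : ℝ)) : ℂ) * (((β * (L : ℝ) ^ 2 : ℝ) : ℂ) * propCT L M β μ K p)) *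
            ((((deriv (fun Λ' : ℝ => hubbardCutoffWeightCT L M β μ K Λ' p') (klScale klE0 n + t * (klScale klE0 (n + 1) - klScale klE0 n)) : ℝ)) : ℂ) *
              (((β * (L : ℝ) ^ 2 : ℝ) : ℂ) * propCT L M β μ K p')) +
          ((((deriv (fun Λ' : ℝ => hubbardCutoffWeightCT L M β μ K Λ' p) (klScale klE0 n + t * (klScale klE0 (n + 1) - klScale klE0 n)) : ℝ)) : ℂ) *
              (((β * (L : ℝ) ^ 2 : ℝ) : ℂ) * propCT L M β μ K p)) *
            ((((softSymbolCompl L M β μ K (n + 1) j p' + (hubbardCutoffWeightCT L M β μ K (klScale klE0 (n + 1)) p' - hubbardCutoffWeightCT L M β μ K (klScale klE0 n + t * (klScale klE0 (n + 1) - klScale klE0 n)) p') : ℝ)) : ℂ) * (((β * (L : ℝ) ^ 2 : ℝ) : ℂ) * propCT L M β μ K p'))‖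
      else 0) ≤
      256 / 3 * (β * (L : ℝ) ^ 2) ^ 2 / (klScale klE0 n + t * (klScale klE0 (n + 1) - klScale klE0 n)) ^ 2 *
        (9 * A * (L : ℝ) ^ 2 / (2 * π ^ 2) *
          ((2 * (klScale klE0 n + t * (klScale klE0 (n + 1) - klScale klE0 n)) + (4 + 8 / 3 * R.Gfr 1 * U ^ 2) * (2 * π / L)) / r +
            Real.sqrt (2 * (klScale klE0 n + t * (klScale klE0 (n + 1) - klScale klE0 n)) + (4 + 8 / 3 * R.Gfr 1 * U ^ 2) * (2 * π / L))) *
          (β * (klScale klE0 n + t * (klScale klE0 (n + 1) - klScale klE0 n)) / π * (10 + 2 * (4 + 8 / 3 * R.Gfr 1 * U ^ 2) * β / L) +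
            12 * (4 + 8 / 3 * R.Gfr 1 * U ^ 2) * β / L)) := by
  classical
  set Λ : ℝ := klScale klE0 n + t * (klScale klE0 (n + 1) - klScale klE0 n) with hΛdef
  have hΛ : 0 < Λ := scaleAt_pos n ht
  have hβL : 0 < β * (L : ℝ) ^ 2 := by
    have : (0 : ℝ) < L := by exact_mod_cast Nat.pos_of_ne_zero (NeZero.ne L)
    positivity
  set G : ℝ := 4 + 8 / 3 * R.Gfr 1 * U ^ 2 with hG
  set q : TorusSite 2 L := Qm - x - y with hq
  have h2Λ : 2 * Λ ≤ 2 * Λ := le_rfl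
  have hE : 2 * Λ + G * (2 * π / L) ≤ klE0 := by have := (scaleAt_mem n ht).2; rw [← hΛdef] at this; linarith
  have hlo : klScale klE0 (n + 1) ≤ Λ := by have := (scaleAt_mem n ht).1; rw [← hΛdef] at this; exact this
  set W : ℝ := 9 * A * (L : ℝ) ^ 2 / (2 * π ^ 2) * ((2 * Λ + G * (2 * π / L)) / r + Real.sqrt (2 * Λ + G * (2 * π / L))) *
      (β * Λ / π * (10 + 2 * G * β / L) + 12 * G * β / L) with hW
  have hrq : r ≤ klTorusNorm L q := by rw [hq, show Qm - x - y = -(x + y - Qm) by abel, klvr_klTorusNorm_neg]; exact hrw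
  have hrnq : r ≤ klTorusNorm L (-q) := by rw [hq, show -(Qm - x - y) = x + y - Qm by abel]; exact hrw
  have hWq : ∑ p ∈ univ.filter (fun p : FreqMomentum L M => matsubaraFreq β M p.1 ^ 2 + nambuXiCT L μ K p.2 ^ 2 ≤ Λ ^ 2 ∧
      |nambuXiCT L μ K (p.2 - q)| ≤ 2 * Λ), (Real.sqrt (matsubaraFreq β M p.1 ^ 2 + nambuXiCT L μ K p.2 ^ 2))⁻¹ ≤ W :=
    twoShell_weighted_sum_le h hA hR hU hUu hμ hK hβ hΛ h2Λ hE q hr hrq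
  have hWnq : ∑ p ∈ univ.filter (fun p : FreqMomentum L M => matsubaraFreq β M p.1 ^ 2 + nambuXiCT L μ K p.2 ^ 2 ≤ Λ ^ 2 ∧
      |nambuXiCT L μ K (p.2 - -q)| ≤ 2 * Λ), (Real.sqrt (matsubaraFreq β M p.1 ^ 2 + nambuXiCT L μ K p.2 ^ 2))⁻¹ ≤ W :=
    twoShell_weighted_sum_le h hA hR hU hUu hμ hK hβ hΛ h2Λ hE (-q) hr hrnq
  have hW0 : 0 ≤ W := le_trans (Finset.sum_nonneg fun p _ => inv_nonneg.2 (Real.sqrt_nonneg _)) hWq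
  -- abbreviations
  set D : FreqMomentum L M → ℝ := fun p => softSymbolCompl L M β μ K (n + 1) j p +
    (hubbardCutoffWeightCT L M β μ K (klScale klE0 (n + 1)) p - hubbardCutoffWeightCT L M β μ K Λ p) with hDdef
  set Wd : FreqMomentum L M → ℝ := fun p => deriv (fun Λ' : ℝ => hubbardCutoffWeightCT L M β μ K Λ' p) Λ with hWddef
  set c : FreqMomentum L M → FreqMomentum L M → Prop := fun p p' =>
    matsubaraInt M p'.1 + matsubaraInt M (omega0 M) + matsubaraInt M (omega0 M) + 1 = matsubaraInt M p.1 ∧ p'.2 = p.2 + Qm - x - y with hc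
  set C0 : ℝ := (β * (L : ℝ) ^ 2) ^ 2 * (128 / (3 * Λ ^ 2)) with hC0
  have hC00 : 0 ≤ C0 := by positivity
  -- the two indicator functions
  set gA : FreqMomentum L M → ℝ := fun p => if matsubaraFreq β M p.1 ^ 2 + nambuXiCT L μ K p.2 ^ 2 ≤ Λ ^ 2 ∧
      |nambuXiCT L μ K (p.2 + q)| ≤ 2 * Λ then (Real.sqrt (matsubaraFreq β M p.1 ^ 2 + nambuXiCT L μ K p.2 ^ 2))⁻¹ else 0 with hgA
  set gB : FreqMomentum L M → ℝ := fun p' => if matsubaraFreq β M p'.1 ^ 2 + nambuXiCT L μ K p'.2 ^ 2 ≤ Λ ^ 2 ∧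
      |nambuXiCT L μ K (p'.2 - q)| ≤ 2 * Λ then (Real.sqrt (matsubaraFreq β M p'.1 ^ 2 + nambuXiCT L μ K p'.2 ^ 2))⁻¹ else 0 with hgB
  have hgA0 : ∀ p, 0 ≤ gA p := fun p => by simp only [hgA]; split_ifs <;> positivity
  have hgB0 : ∀ p, 0 ≤ gB p := fun p => by simp only [hgB]; split_ifs <;> positivity
  -- step 1: split the summand
  have hsplit : ∀ p p' : FreqMomentum L M,
      (if c p p' then ‖(((D p : ℝ) : ℂ) * (((β * (L : ℝ) ^ 2 : ℝ) : ℂ) * propCT L M β μ K p)) * (((Wd p' : ℝ) : ℂ) * (((β * (L : ℝ) ^ 2 : ℝ) : ℂ) * propCT L M β μ K p')) +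
          (((Wd p : ℝ) : ℂ) * (((β * (L : ℝ) ^ 2 : ℝ) : ℂ) * propCT L M β μ K p)) * (((D p' : ℝ) : ℂ) * (((β * (L : ℝ) ^ 2 : ℝ) : ℂ) * propCT L M β μ K p'))‖ else 0) ≤
      (if c p p' then |D p| * ((β * (L : ℝ) ^ 2) * ‖propCT L M β μ K p‖) * (|Wd p'| * ((β * (L : ℝ) ^ 2) * ‖propCT L M β μ K p'‖)) else 0) +
      (if c p p' then |D p'| * ((β * (L : ℝ) ^ 2) * ‖propCT L M β μ K p'‖) * (|Wd p| * ((β * (L : ℝ) ^ 2) * ‖propCT L M β μ K p‖)) else 0) := by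
    intro p p'
    split_ifs with hcc
    · refine (norm_add_le _ _).trans (add_le_add (le_of_eq (norm_weightProd_eq hβ μ K _ _ p p')) (le_of_eq ?_))
      rw [norm_weightProd_eq hβ μ K]; ring
    · simp
  -- step 2: part A — collapse the partner sum at fixed `p`
  have hA' : ∀ p : FreqMomentum L M,
      (∑ p' : FreqMomentum L M, if c p p' then |D p| * ((β * (L : ℝ) ^ 2) * ‖propCT L M β μ K p‖) * (|Wd p'| * ((β * (L : ℝ) ^ 2) * ‖propCT L M β μ K p'‖)) else 0) ≤
      C0 * gA p := by
    intro p
    refine sum_ite_le_of_card_le_one _ _ _ (mul_nonneg hC00 (hgA0 p)) (fun p' _ hcc => ?_) (card_partner_le_one Qm x y p)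
    have hb := memberCrossProd_le_indicator hβ μ K n hj hlo hΛ p p'
    have e : p'.2 = p.2 + q := by rw [hcc.2, hq]; abel
    rw [e] at hb
    exact hb
  -- step 3: part B — collapse the source sum at fixed `p′`
  have hB' : ∀ p' : FreqMomentum L M,
      (∑ p : FreqMomentum L M, if c p p' then |D p'| * ((β * (L : ℝ) ^ 2) * ‖propCT L M β μ K p'‖) * (|Wd p| * ((β * (L : ℝ) ^ 2) * ‖propCT L M β μ K p‖)) else 0) ≤
      C0 * gB p' := by
    intro p'
    refine sum_ite_le_of_card_le_one _ (fun p => c p p') _ (mul_nonneg hC00 (hgB0 p')) (fun p _ hcc => ?_) (card_source_le_one Qm x y p')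
    have hb := memberCrossProd_le_indicator hβ μ K n hj hlo hΛ p' p
    have e : p.2 = p'.2 - q := by rw [hcc.2, hq]; abel
    rw [e] at hb
    exact hb
  -- step 4: the two weighted sums
  have hSA : ∑ p : FreqMomentum L M, gA p ≤ W := by
    rw [hgA, ← Finset.sum_filter]
    have e : (univ.filter fun p : FreqMomentum L M => matsubaraFreq β M p.1 ^ 2 + nambuXiCT L μ K p.2 ^ 2 ≤ Λ ^ 2 ∧
        |nambuXiCT L μ K (p.2 + q)| ≤ 2 * Λ) = univ.filter fun p : FreqMomentum L M => matsubaraFreq β M p.1 ^ 2 + nambuXiCT L μ K p.2 ^ 2 ≤ Λ ^ 2 ∧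
        |nambuXiCT L μ K (p.2 - -q)| ≤ 2 * Λ := by
      congr 1; funext p; rw [sub_neg_eq_add]
    rw [e]; exact hWnq
  have hSB : ∑ p : FreqMomentum L M, gB p ≤ W := by
    rw [hgB, ← Finset.sum_filter]; exact hWq
  -- assemble
  simp only [hDdef, hWddef, hc] at hsplit
  calc _ ≤ ∑ p : FreqMomentum L M, ∑ p' : FreqMomentum L M,
        ((if c p p' then |D p| * ((β * (L : ℝ) ^ 2) * ‖propCT L M β μ K p‖) * (|Wd p'| * ((β * (L : ℝ) ^ 2) * ‖propCT L M β μ K p'‖)) else 0) +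
         (if c p p' then |D p'| * ((β * (L : ℝ) ^ 2) * ‖propCT L M β μ K p'‖) * (|Wd p| * ((β * (L : ℝ) ^ 2) * ‖propCT L M β μ K p‖)) else 0)) :=
        Finset.sum_le_sum fun p _ => Finset.sum_le_sum fun p' _ => hsplit p p'
    _ = ∑ p : FreqMomentum L M, ∑ p' : FreqMomentum L M,
          (if c p p' then |D p| * ((β * (L : ℝ) ^ 2) * ‖propCT L M β μ K p‖) * (|Wd p'| * ((β * (L : ℝ) ^ 2) * ‖propCT L M β μ K p'‖)) else 0) +
        ∑ p' : FreqMomentum L M, ∑ p : FreqMomentum L M,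
          (if c p p' then |D p'| * ((β * (L : ℝ) ^ 2) * ‖propCT L M β μ K p'‖) * (|Wd p| * ((β * (L : ℝ) ^ 2) * ‖propCT L M β μ K p‖)) else 0) := by
        rw [Finset.sum_comm (f := fun p' p => if c p p' then |D p'| * ((β * (L : ℝ) ^ 2) * ‖propCT L M β μ K p'‖) *
          (|Wd p| * ((β * (L : ℝ) ^ 2) * ‖propCT L M β μ K p‖)) else 0), ← Finset.sum_add_distrib]
        exact Finset.sum_congr rfl fun p _ => Finset.sum_add_distrib
    _ ≤ ∑ p : FreqMomentum L M, C0 * gA p + ∑ p' : FreqMomentum L M, C0 * gB p' := add_le_add (Finset.sum_le_sum fun p _ => hA' p) (Finset.sum_le_sum fun p' _ => hB' p')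
    _ = C0 * (∑ p : FreqMomentum L M, gA p + ∑ p' : FreqMomentum L M, gB p') := by rw [mul_add, Finset.mul_sum, Finset.mul_sum]
    _ ≤ C0 * (W + W) := by gcongr
    _ = 256 / 3 * (β * (L : ℝ) ^ 2) ^ 2 / Λ ^ 2 * W := by rw [hC0]; field_simp; ring

end Summit.HubbardSuperconductivity.HubbardSuperconductivity.Theorems.KLRegimeSplit

end
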